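import Mathlib
import Summits.ValiantsHypothesis.ValiantsHypothesis.Theses.LiouvilleSarnak
import Summits.ValiantsHypothesis.ValiantsHypothesis.Theorems.LiouvilleSarnakLiouvilleCutRankFourPointLogChowla

/-!
# Route LiouvilleSarnak — crux `LiouvilleCutRank` (stmt-ValiantsHypothesis-14775):
# ONLY PARALLELOGRAM (ADDITIVE-QUADRUPLE) FOUR-POINT CORRELATIONS ARE NEEDED

`Theorems/LiouvilleSarnakLiouvilleCutRankFourPointLogChowla.lean` derived the crux from the `k = 4`
case of the logarithmically averaged Chowla conjecture along the progressions `n ≡ b (mod 4^ℓ)`, for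
ALL quadruples of distinct shifts.  The four shifts actually used are the corners of a digital
rectangle, `N(r,c)+1, N(r',c)+1, N(r,c')+1, N(r',c')+1`, and the cut address is additive in its row and
column digits (`cutAddress_eq_add`: `N_{π₁}(r, c) = N_{π₁}(r, 0) + N_{π₁}(0, c)`), so these corners form an
ADDITIVE QUADRUPLE: `b₁ + b₄ = b₂ + b₃` (`cutAddress_parallelogram`).  Hence:

* ★ `liouvilleCutRank_of_parallelogram_logChowla` — `LiouvilleCutRank` follows from the logarithmic
  four-point statement restricted to PARALLELOGRAM patterns
  `λ(x) λ(x + h) λ(x + k) λ(x + h + k)`, `x ≡ b (mod 4^ℓ)`, with FIXED differences `h, k`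
  inside one block: for every `ℓ` and all pairwise distinct `b₁, b₂, b₃, b₄ ∈ [1, 4^ℓ]` with
  `b₁ + b₄ = b₂ + b₃`,
  `Σ_{n ≤ x} λ(4^ℓ n + b₁) λ(4^ℓ n + b₂) λ(4^ℓ n + b₃) λ(4^ℓ n + b₄) / n = o(log x)`.

Reading.  These are exactly the fixed-difference `U²`-type ("second Gowers–Host–Kra") correlations of
`λ` along 4-adic progressions — the local-uniformity currency of Tao–Teräväinen's reduction of the
even-order logarithmic Chowla conjecture (Duke Math. J. 168 (2019)); the AVERAGE of such
parallelogram correlations over all differences `h, k ≤ X` is the Gowers `U²` norm of `λ`, which IS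
`o(1)` unconditionally (Davenport's exponential-sum bound), whereas fixed differences inside one
block are the open regime.  So the minimal input for the crux along this line is:
fixed-difference parallelogram correlations of `λ` in progressions of modulus `4^ℓ`, logarithmically
averaged — and (barrier file `…PairCorrelationBarrier.lean`) no pair or odd-order statistic can
replace them.

Honest framing: a sharpening of the hypothesis of a conditional bridge; the hypothesis stays OPEN,
`LiouvilleCutRank` stays OPEN, nothing here bears on VP versus VNP.  No definitions.  The proof
repeats the argument of `…FourPointLogChowla.lean` verbatim (append-only tree), feeding the extra
side condition from `cutAddress_parallelogram`.
-/

-- the directory `ValiantsHypothesis/ValiantsHypothesis` repeats the summit name (tree layout)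
set_option linter.dupNamespace false

namespace Summit.ValiantsHypothesis.ValiantsHypothesis.Theorems.LiouvilleSarnakLiouvilleCutRank.FourPointParallelogram

open Finset ArithmeticFunction Filter Asymptotics

open Summit.ValiantsHypothesis.ValiantsHypothesis.Theses.LiouvilleSarnak (LiouvilleCutRank)
open Summit.ValiantsHypothesis.ValiantsHypothesis.Theorems.LiouvilleSarnakLiouvilleCutRank.OneBlock
  (liouvilleCutRank_iff_oneBlock_distinctRows)
open Summit.ValiantsHypothesis.ValiantsHypothesis.Theorems.LiouvilleSarnakLiouvilleCutRank.BlockEntropy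
  (card_image_blockRows_eq liouville_succ_eq_or)
open Summit.ValiantsHypothesis.ValiantsHypothesis.Theorems.LiouvilleSarnakLiouvilleCutRank.GramCount
  (card_sq_le_of_image_card_le not_isLittleO_log_of_one_le)
open Summit.ValiantsHypothesis.ValiantsHypothesis.Theorems.LiouvilleSarnakLiouvilleCutRank.FourPoint
  (cutAddress_injective)

/-! ### §1 The cut address is additive in row and column digits -/

/-- `Nat.ofBits` is additive over Boolean vectors with disjoint supports. [folklore] -/
theorem ofBits_eq_add_of_toNat {m : ℕ} (f g h : Fin m → Bool)
    (hf : ∀ j, (f j).toNat = (g j).toNat + (h j).toNat) :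
    Nat.ofBits f = Nat.ofBits g + Nat.ofBits h := by
  induction m with
  | zero => simp
  | succ m ih =>
    rw [Nat.ofBits_succ, Nat.ofBits_succ, Nat.ofBits_succ,
      ih (f ∘ Fin.succ) (g ∘ Fin.succ) (h ∘ Fin.succ) fun j => hf j.succ, hf 0]
    ring

/-- **Additivity of the cut address.**  `N_{π₁}(r, c) = N_{π₁}(r, 0) + N_{π₁}(0, c)` (row positions and
column positions are disjoint). [folklore] -/
theorem cutAddress_eq_add (ℓ : ℕ) (π₁ : Fin ℓ ⊕ Fin ℓ ≃ Fin (2 * ℓ)) (r c : Fin ℓ → Bool) :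
    Nat.ofBits (fun j : Fin (2 * ℓ) => Sum.elim r c (π₁.symm j)) =
      Nat.ofBits (fun j : Fin (2 * ℓ) => Sum.elim r (fun _ => false) (π₁.symm j)) +
        Nat.ofBits (fun j : Fin (2 * ℓ) => Sum.elim (fun _ => false) c (π₁.symm j)) := by
  refine ofBits_eq_add_of_toNat _ _ _ fun j => ?_
  rcases π₁.symm j with i | i <;> simp

/-- **The corners of a digital rectangle form an additive quadruple.**
`N(r,c) + N(r',c') = N(r',c) + N(r,c')`. [folklore] -/
theorem cutAddress_parallelogram (ℓ : ℕ) (π₁ : Fin ℓ ⊕ Fin ℓ ≃ Fin (2 * ℓ))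
    (r r' c c' : Fin ℓ → Bool) :
    Nat.ofBits (fun j : Fin (2 * ℓ) => Sum.elim r c (π₁.symm j)) +
        Nat.ofBits (fun j : Fin (2 * ℓ) => Sum.elim r' c' (π₁.symm j)) =
      Nat.ofBits (fun j : Fin (2 * ℓ) => Sum.elim r' c (π₁.symm j)) +
        Nat.ofBits (fun j : Fin (2 * ℓ) => Sum.elim r c' (π₁.symm j)) := by
  rw [cutAddress_eq_add ℓ π₁ r c, cutAddress_eq_add ℓ π₁ r' c', cutAddress_eq_add ℓ π₁ r' c,
    cutAddress_eq_add ℓ π₁ r c']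
  ring

/-! ### §2 Parallelogram four-point logarithmic Chowla along 4-adic progressions ⇒ the crux -/

/-- ★ **Parallelogram four-point logarithmic Chowla along 4-adic progressions implies
`LiouvilleCutRank`.**  Hypothesis (OPEN): for every `ℓ` and every ADDITIVE quadruple
`b₁ + b₄ = b₂ + b₃` of pairwise distinct shifts `1 ≤ b_i ≤ 4^ℓ` — i.e. every parallelogram pattern
`x, x + h, x + k, x + h + k` with fixed differences inside one block —
`Σ_{1 ≤ n ≤ x} λ(4^ℓ n + b₁) λ(4^ℓ n + b₂) λ(4^ℓ n + b₃) λ(4^ℓ n + b₄) / n = o(log x)`.  Conclusion: for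
every `W`, eventually every balanced digital cut matrix of `λ` has rank `≥ W`.  Same proof as
`FourPoint.liouvilleCutRank_of_fourPoint_logChowla`; the rectangle corners
`N(r,c)+1, N(r',c')+1, N(r',c)+1, N(r,c')+1` are an additive quadruple by
`cutAddress_parallelogram`. [folklore] -/
theorem liouvilleCutRank_of_parallelogram_logChowla
    (h4 : ∀ ℓ b₁ b₂ b₃ b₄ : ℕ, b₁ + b₄ = b₂ + b₃ → b₁ ≠ b₂ → b₁ ≠ b₃ → b₁ ≠ b₄ → b₂ ≠ b₃ → b₂ ≠ b₄ → b₃ ≠ b₄ →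
      1 ≤ b₁ → 1 ≤ b₂ → 1 ≤ b₃ → 1 ≤ b₄ →
      b₁ ≤ 2 ^ (2 * ℓ) → b₂ ≤ 2 ^ (2 * ℓ) → b₃ ≤ 2 ^ (2 * ℓ) → b₄ ≤ 2 ^ (2 * ℓ) →
      (fun x : ℕ => ∑ n ∈ Icc 1 x,
        ((liouville (2 ^ (2 * ℓ) * n + b₁) : ℝ) * (liouville (2 ^ (2 * ℓ) * n + b₂) : ℝ) *
          (liouville (2 ^ (2 * ℓ) * n + b₃) : ℝ) * (liouville (2 ^ (2 * ℓ) * n + b₄) : ℝ)) / n)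
        =o[atTop] fun x : ℕ => Real.log x) :
    LiouvilleCutRank := by
  classical
  rw [liouvilleCutRank_iff_oneBlock_distinctRows]
  intro D
  -- a scale with `3 D ≤ 2^ℓ`
  obtain ⟨ℓ, hℓ⟩ : ∃ ℓ : ℕ, 3 * D ≤ 2 ^ ℓ := ⟨3 * D, Nat.lt_two_pow_self.le⟩
  refine ⟨ℓ, fun π₁ => ?_⟩
  by_contra hcon
  push Not at hcon
  -- notation: addresses and the integer block matrices
  set N : (Fin ℓ → Bool) → (Fin ℓ → Bool) → ℕ := fun r c =>
    Nat.ofBits (fun j : Fin (2 * ℓ) => Sum.elim r c (π₁.symm j)) with hNdef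
  set B : ℕ → (Fin ℓ → Bool) → (Fin ℓ → Bool) → ℤ := fun H r c =>
    (liouville (N r c + 2 ^ (2 * ℓ) * H + 1) : ℤ) with hBdef
  have hB : ∀ H r c, B H r c = 1 ∨ B H r c = -1 := fun H r c => liouville_succ_eq_or _
  have hNinj : ∀ r r' c c', N r c = N r' c' → r = r' ∧ c = c' :=
    fun r r' c c' h => cutAddress_injective ℓ π₁ r r' c c' h
  have hNle : ∀ r c, N r c + 1 ≤ 2 ^ (2 * ℓ) := fun r c => Nat.ofBits_lt_two_pow _
  have hNpar : ∀ r r' c c', N r c + N r' c' = N r' c + N r c' :=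
    fun r r' c c' => cutAddress_parallelogram ℓ π₁ r r' c c'
  -- every block has `≤ D - 1` distinct (integer) rows
  have hrows : ∀ H, ((univ : Finset (Fin ℓ → Bool)).image (B H)).card ≤ D - 1 := by
    intro H
    have h1 := hcon H
    rw [card_image_blockRows_eq ℓ H π₁] at h1
    exact Nat.le_sub_one_of_lt h1
  have hcardN : Fintype.card (Fin ℓ → Bool) = 2 ^ ℓ := by simp
  -- the off-diagonal four-fold sum of every block is `≥ 1`
  set OD : ℕ → ℤ := fun H => ∑ p ∈ (univ : Finset (Fin ℓ → Bool)).offDiag,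
      ∑ q ∈ (univ : Finset (Fin ℓ → Bool)).offDiag,
        B H p.1 q.1 * B H p.2 q.1 * B H p.1 q.2 * B H p.2 q.2 with hOD
  have hOD1 : ∀ H, 1 ≤ OD H := by
    intro H
    have hG := card_sq_le_of_image_card_le (B H) (hB H) (D - 1) (hrows H)
    rw [hcardN] at hG
    -- `1 ≤ D - 1`: a block has at least one row
    have hD1 : 1 ≤ D - 1 := by
      have h0 : 0 < ((univ : Finset (Fin ℓ → Bool)).image (B H)).card :=
        card_pos.mpr ⟨B H (fun _ => false), mem_image_of_mem _ (mem_univ _)⟩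
      have := hrows H
      omega
    set D' : ℕ := D - 1 with hD'
    have hM3 : 3 * D' ≤ 2 ^ ℓ := le_trans (by omega) hℓ
    -- cast everything to `ℤ`
    have hM3' : 3 * (D' : ℤ) ≤ (2 : ℤ) ^ ℓ := by exact_mod_cast hM3
    have hD1' : (1 : ℤ) ≤ (D' : ℤ) := by exact_mod_cast hD1
    have hG' : (((2 ^ ℓ : ℕ) : ℤ) * ((2 ^ ℓ : ℕ) : ℤ)) ^ 2 ≤
        (D' : ℤ) * OD H + (D' : ℤ) * (((2 ^ ℓ : ℕ) : ℤ) * ((2 ^ ℓ : ℕ) : ℤ) *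
          (((2 ^ ℓ : ℕ) : ℤ) + ((2 ^ ℓ : ℕ) : ℤ))) := hG
    push_cast at hG'
    set M : ℤ := (2 : ℤ) ^ ℓ with hM
    have hM1 : (3 : ℤ) ≤ M := by linarith
    have hM3pos : (0 : ℤ) ≤ M * M * M := by positivity
    have h1 : 3 * (D' : ℤ) * (M * M * M) ≤ M * (M * M * M) :=
      mul_le_mul_of_nonneg_right hM3' hM3pos
    have h2 : (27 : ℤ) ≤ M * M * M := by nlinarith
    have h3 : (D' : ℤ) * 27 ≤ (D' : ℤ) * (M * M * M) :=
      mul_le_mul_of_nonneg_left h2 (by positivity)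
    by_contra hlt
    push Not at hlt
    have h4' : (D' : ℤ) * OD H < (D' : ℤ) * 1 := mul_lt_mul_of_pos_left hlt (by linarith)
    nlinarith
  -- the four-fold products as products of four Liouville values in one progression
  have e : ∀ m H : ℕ, m + 2 ^ (2 * ℓ) * H + 1 = 2 ^ (2 * ℓ) * H + (m + 1) := by intros; ring
  have hterm : ∀ (H : ℕ) (p q : (Fin ℓ → Bool) × (Fin ℓ → Bool)),
      ((B H p.1 q.1 * B H p.2 q.1 * B H p.1 q.2 * B H p.2 q.2 : ℤ) : ℝ) =
        ((liouville (2 ^ (2 * ℓ) * H + (N p.1 q.1 + 1)) : ℝ) *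
          (liouville (2 ^ (2 * ℓ) * H + (N p.2 q.1 + 1)) : ℝ) *
          (liouville (2 ^ (2 * ℓ) * H + (N p.1 q.2 + 1)) : ℝ) *
          (liouville (2 ^ (2 * ℓ) * H + (N p.2 q.2 + 1)) : ℝ)) := by
    intro H p q
    simp only [hBdef, e]
    push_cast
    rfl
  have hODr : ∀ n : ℕ, (OD n : ℝ) =
      ∑ p ∈ (univ : Finset (Fin ℓ → Bool)).offDiag, ∑ q ∈ (univ : Finset (Fin ℓ → Bool)).offDiag,
        ((liouville (2 ^ (2 * ℓ) * n + (N p.1 q.1 + 1)) : ℝ) *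
          (liouville (2 ^ (2 * ℓ) * n + (N p.2 q.1 + 1)) : ℝ) *
          (liouville (2 ^ (2 * ℓ) * n + (N p.1 q.2 + 1)) : ℝ) *
          (liouville (2 ^ (2 * ℓ) * n + (N p.2 q.2 + 1)) : ℝ)) := by
    intro n
    simp only [hOD]
    rw [Int.cast_sum]
    refine sum_congr rfl fun p _ => ?_
    rw [Int.cast_sum]
    exact sum_congr rfl fun q _ => hterm n p q
  have hsumeq : ∀ x : ℕ, ∑ n ∈ Icc 1 x, (OD n : ℝ) / n =
      ∑ p ∈ (univ : Finset (Fin ℓ → Bool)).offDiag, ∑ q ∈ (univ : Finset (Fin ℓ → Bool)).offDiag,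
        ∑ n ∈ Icc 1 x,
          ((liouville (2 ^ (2 * ℓ) * n + (N p.1 q.1 + 1)) : ℝ) *
            (liouville (2 ^ (2 * ℓ) * n + (N p.2 q.1 + 1)) : ℝ) *
            (liouville (2 ^ (2 * ℓ) * n + (N p.1 q.2 + 1)) : ℝ) *
            (liouville (2 ^ (2 * ℓ) * n + (N p.2 q.2 + 1)) : ℝ)) / n := by
    intro x
    calc ∑ n ∈ Icc 1 x, (OD n : ℝ) / n
        = ∑ n ∈ Icc 1 x, ∑ p ∈ (univ : Finset (Fin ℓ → Bool)).offDiag,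
            ∑ q ∈ (univ : Finset (Fin ℓ → Bool)).offDiag,
              ((liouville (2 ^ (2 * ℓ) * n + (N p.1 q.1 + 1)) : ℝ) *
                (liouville (2 ^ (2 * ℓ) * n + (N p.2 q.1 + 1)) : ℝ) *
                (liouville (2 ^ (2 * ℓ) * n + (N p.1 q.2 + 1)) : ℝ) *
                (liouville (2 ^ (2 * ℓ) * n + (N p.2 q.2 + 1)) : ℝ)) / n := by
          refine sum_congr rfl fun n _ => ?_
          rw [hODr n, sum_div]
          refine sum_congr rfl fun p _ => ?_
          rw [sum_div]
      _ = _ := by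
          rw [sum_comm]
          exact sum_congr rfl fun p _ => sum_comm
  -- hence the logarithmic average of `OD` is `o(log x)`
  have hlittle : (fun x : ℕ => ∑ n ∈ Icc 1 x, (OD n : ℝ) / n) =o[atTop]
      fun x : ℕ => Real.log x := by
    rw [show (fun x : ℕ => ∑ n ∈ Icc 1 x, (OD n : ℝ) / n) = _ from funext hsumeq]
    refine IsLittleO.sum fun p hp => IsLittleO.sum fun q hq => ?_
    have hpne : p.1 ≠ p.2 := (mem_offDiag.mp hp).2.2
    have hqne : q.1 ≠ q.2 := (mem_offDiag.mp hq).2.2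
    refine h4 ℓ (N p.1 q.1 + 1) (N p.2 q.1 + 1) (N p.1 q.2 + 1) (N p.2 q.2 + 1)
      (by have := hNpar p.1 p.2 q.1 q.2; omega)
      ?_ ?_ ?_ ?_ ?_ ?_ (by omega) (by omega) (by omega) (by omega)
      (hNle _ _) (hNle _ _) (hNle _ _) (hNle _ _)
    · exact fun h => hpne (hNinj _ _ _ _ (Nat.succ_injective h)).1
    · exact fun h => hqne (hNinj _ _ _ _ (Nat.succ_injective h)).2
    · exact fun h => hpne (hNinj _ _ _ _ (Nat.succ_injective h)).1
    · exact fun h => hpne (hNinj _ _ _ _ (Nat.succ_injective h)).1.symm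
    · exact fun h => hqne (hNinj _ _ _ _ (Nat.succ_injective h)).2
    · exact fun h => hpne (hNinj _ _ _ _ (Nat.succ_injective h)).1
  exact not_isLittleO_log_of_one_le (a := fun n => (OD n : ℝ))
    (fun n _ => by exact_mod_cast hOD1 n) hlittle


end Summit.ValiantsHypothesis.ValiantsHypothesis.Theorems.LiouvilleSarnakLiouvilleCutRank.FourPointParallelogram
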